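import Summits.BirchSwinnertonDyer.BirchSwinnertonDyer.Theorems.EdixhovenFibreFiveSevenStarredOptimalManinUnitFiveSevenHcorTwoAdicStep
import HarnessLib

set_option autoImplicit false
-- the sub-problem namespace `Summit.BirchSwinnertonDyer.BirchSwinnertonDyer` duplicates a component by design (D-0017)
set_option linter.dupNamespace false

/-!
# K★ line `cdt_thm1`, stub `stub_hcor_invariant`: ALL levels

Crux `StarredOptimalManinUnitFiveSeven` (stmt-BirchSwinnertonDyer-22226); skeleton v17 has the single stub
`stub_hcor_invariant` (the invariant form of [CalegariDimitrovTang2025, Corollary 4.5.3], all `N`).  From the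
levels with `4 ∤ N` (`…HcorPrimePow`) and the `2`-adic depth step (`…HcorTwoAdicStep.two_adic_step`), by
strong induction on `N` and the prime-by-prime corestriction:

* `cor453_invariant_form` — **for every `N ≥ 1` and every finite commutative `Q`, every `SL₂(ℤ)`-conjugation-
  invariant `θ : Γ(N) → Q` is trivial on `Γ(12N)`**;
* `stub_hcor_invariant_all` — the stub `stub_hcor_invariant` in its exact shape, for all `N`;
* `Gamma_mul_le_commutator : Γ(12N) ≤ [SL₂(ℤ), Γ(N)]` for all `N ≥ 1` ([Beyl1986]'s level is `lcm(N,12)`).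

K★ / Manin / BSD are not proved in this file (the composition with the rest of line `cdt_thm1` is separate).
-/

open scoped MatrixGroups commutatorElement

namespace Summit.BirchSwinnertonDyer.BirchSwinnertonDyer.Theorems

namespace HcorTwoPow

open CongruenceSubgroup Matrix.SpecialLinearGroup ModularGroup
open Literature.NumberTheory.Automorphic.UnboundedDenominators

/-- `Γ(L) ≤ Γ(M)` for `M ∣ L`. [folklore] -/
private theorem Gamma_le_Gamma_of_dvd₁₇ {M L : ℕ} (h : M ∣ L) : Gamma L ≤ Gamma M := by
  intro γ hγ
  obtain ⟨h00, h01, h10, h11⟩ := Gamma_mem.mp hγ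
  have cast_eq : ∀ a : ℤ, ((a : ZMod L).cast : ZMod M) = (a : ZMod M) := fun a ↦
    ZMod.cast_intCast h a
  rw [Gamma_mem]
  refine ⟨?_, ?_, ?_, ?_⟩
  · rw [← cast_eq, h00, ZMod.cast_one h]
  · rw [← cast_eq, h01, ZMod.cast_zero]
  · rw [← cast_eq, h10, ZMod.cast_zero]
  · rw [← cast_eq, h11, ZMod.cast_one h]

/-- The `2`-adic depth step with the level as a variable. [cite: CalegariDimitrovTang2025, Corollary 4.5.3] -/
private theorem two_adic_step' {N M : ℕ} (hN : N = M * 2) (hM0 : M ≠ 0) (hM2 : 2 ∣ M)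
    (hIH : ∀ (Q' : Type) [CommGroup Q'] [Finite Q'] (a' : ℕ), (∀ q : Q', q ^ (2 ^ a') = 1) →
      ∀ (ψ : Gamma M →* Q'),
      (∀ (g x : SL(2, ℤ)) (hx : x ∈ Gamma M) (hgx : g * x * g⁻¹ ∈ Gamma M),
        ψ ⟨g * x * g⁻¹, hgx⟩ = ψ ⟨x, hx⟩) →
      ∀ (x : SL(2, ℤ)) (hx : x ∈ Gamma M), x ∈ Gamma (12 * M) → ψ ⟨x, hx⟩ = 1)
    (Q : Type) [CommGroup Q] [Finite Q] (a : ℕ) (hQ : ∀ q : Q, q ^ (2 ^ a) = 1)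
    (θ : Gamma N →* Q)
    (hθ : ∀ (g x : SL(2, ℤ)) (hx : x ∈ Gamma N) (hgx : g * x * g⁻¹ ∈ Gamma N),
      θ ⟨g * x * g⁻¹, hgx⟩ = θ ⟨x, hx⟩) :
    ∀ (x : SL(2, ℤ)) (hx : x ∈ Gamma N), x ∈ Gamma (12 * N) → θ ⟨x, hx⟩ = 1 := by
  subst hN
  exact HcorTwoAdicStep.two_adic_step hM0 hM2 hIH Q a hQ θ hθ

/-- **Targets of `2`-power exponent, all levels.**  Every `SL₂(ℤ)`-conjugation-invariant `θ : Γ(N) → Q`,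
`N ≥ 1`, `Q` finite commutative of exponent `2^a`, is trivial on `Γ(12N)` (strong induction on `N`).
[cite: CalegariDimitrovTang2025, Corollary 4.5.3] [cite: Beyl1986, Theorem] -/
theorem cor453_invariant_form_exponent_two :
    ∀ {N : ℕ}, N ≠ 0 → ∀ (Q : Type) [CommGroup Q] [Finite Q] (a : ℕ),
      (∀ q : Q, q ^ (2 ^ a) = 1) → ∀ (θ : Gamma N →* Q),
      (∀ (g x : SL(2, ℤ)) (hx : x ∈ Gamma N) (hgx : g * x * g⁻¹ ∈ Gamma N),
        θ ⟨g * x * g⁻¹, hgx⟩ = θ ⟨x, hx⟩) →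
      ∀ (x : SL(2, ℤ)) (hx : x ∈ Gamma N), x ∈ Gamma (12 * N) → θ ⟨x, hx⟩ = 1 := by
  intro N
  induction N using Nat.strong_induction_on with
  | _ N ih =>
  intro hN0 Q _ _ a hQ θ hθ x hx hx12
  by_cases h4 : 4 ∣ N
  · obtain ⟨c, hc⟩ := h4
    have hNM : N = 2 * c * 2 := by rw [hc]; ring
    have hM0 : 2 * c ≠ 0 := by
      intro h; apply hN0; rw [hNM, h, zero_mul]
    have hMlt : 2 * c < N := by
      rw [hNM]; exact lt_mul_of_one_lt_right (Nat.pos_of_ne_zero hM0) one_lt_two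
    have hIH : ∀ (Q' : Type) [CommGroup Q'] [Finite Q'] (a' : ℕ), (∀ q : Q', q ^ (2 ^ a') = 1) →
        ∀ (ψ : Gamma (2 * c) →* Q'),
        (∀ (g y : SL(2, ℤ)) (hy : y ∈ Gamma (2 * c)) (hgy : g * y * g⁻¹ ∈ Gamma (2 * c)),
          ψ ⟨g * y * g⁻¹, hgy⟩ = ψ ⟨y, hy⟩) →
        ∀ (y : SL(2, ℤ)) (hy : y ∈ Gamma (2 * c)), y ∈ Gamma (12 * (2 * c)) → ψ ⟨y, hy⟩ = 1 :=
      fun Q' _ _ a' hQ' ψ hψ ↦ ih _ hMlt hM0 Q' a' hQ' ψ hψ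
    exact two_adic_step' hNM hM0 (dvd_mul_right 2 c) hIH Q a hQ θ hθ x hx hx12
  · exact HcorPrimePow.cor453_invariant_form_exponent_of_not_four_dvd Nat.prime_two hN0 (fun _ ↦ h4) Q a hQ θ
      hθ x hx hx12

/-- **Targets of `ℓ`-power exponent, every prime `ℓ`, all levels.** [cite: CalegariDimitrovTang2025, Corollary 4.5.3]
[cite: Beyl1986, Theorem] -/
theorem cor453_invariant_form_exponent {ℓ : ℕ} (hℓ : ℓ.Prime) :
    ∀ {N : ℕ}, N ≠ 0 → ∀ (Q : Type) [CommGroup Q] [Finite Q] (a : ℕ),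
      (∀ q : Q, q ^ (ℓ ^ a) = 1) → ∀ (θ : Gamma N →* Q),
      (∀ (g x : SL(2, ℤ)) (hx : x ∈ Gamma N) (hgx : g * x * g⁻¹ ∈ Gamma N),
        θ ⟨g * x * g⁻¹, hgx⟩ = θ ⟨x, hx⟩) →
      ∀ (x : SL(2, ℤ)) (hx : x ∈ Gamma N), x ∈ Gamma (12 * N) → θ ⟨x, hx⟩ = 1 := by
  intro N hN0 Q _ _ a hQ θ hθ
  by_cases hℓ2 : ℓ = 2
  · subst hℓ2
    exact cor453_invariant_form_exponent_two hN0 Q a hQ θ hθ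
  · exact HcorPrimePow.cor453_invariant_form_exponent_of_not_four_dvd hℓ hN0 (fun h ↦ absurd h hℓ2) Q a hQ θ hθ

/-- **The invariant form of CDT Cor. 4.5.3 for every level `N ≥ 1`**: for every finite commutative `Q`, every
`SL₂(ℤ)`-conjugation-invariant `θ : Γ(N) → Q` is trivial on `Γ(12N)`.
[cite: CalegariDimitrovTang2025, Corollary 4.5.3] [cite: Beyl1986, Theorem] -/
theorem cor453_invariant_form {N : ℕ} (hN0 : N ≠ 0) (Q : Type) [CommGroup Q] [Finite Q] (θ : Gamma N →* Q)
    (hθ : ∀ (g x : SL(2, ℤ)) (hx : x ∈ Gamma N) (hgx : g * x * g⁻¹ ∈ Gamma N),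
      θ ⟨g * x * g⁻¹, hgx⟩ = θ ⟨x, hx⟩) :
    ∀ (x : SL(2, ℤ)) (hx : x ∈ Gamma N), x ∈ Gamma (12 * N) → θ ⟨x, hx⟩ = 1 := by
  intro x hx hx12
  set n : ℕ := Nat.card Q with hn
  have hn0 : n ≠ 0 := Nat.card_pos.ne'
  by_contra hne
  have hord : orderOf (θ ⟨x, hx⟩) ≠ 1 := fun h1 ↦ hne (orderOf_eq_one_iff.mp h1)
  obtain ⟨ℓ, hℓ, hℓq⟩ := Nat.exists_prime_and_dvd hord
  -- corestriction to the `ℓ`-power torsion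
  set m : ℕ := ordCompl[ℓ] n with hm_def
  have hnm : ordProj[ℓ] n * m = n := Nat.ordProj_mul_ordCompl_eq_self n ℓ
  have hpow : ∀ (y : Gamma N), ((powMonoidHom m).comp θ) y = θ y ^ m := fun y ↦ rfl
  have he : ∀ y : Gamma N, ((powMonoidHom m).comp θ) y ^ (ℓ ^ n.factorization ℓ) = 1 := by
    intro y
    rw [hpow, ← pow_mul, mul_comm, hnm, hn]
    exact pow_card_eq_one'
  set T : Subgroup Q := (powMonoidHom (ℓ ^ n.factorization ℓ) : Q →* Q).ker with hT
  set θT : Gamma N →* T := ((powMonoidHom m).comp θ).codRestrict T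
    (fun y ↦ by rw [hT, MonoidHom.mem_ker, powMonoidHom_apply]; exact he y) with hθT
  have hθTval : ∀ y : Gamma N, ((θT y : T) : Q) = θ y ^ m := fun y ↦ rfl
  have hQT : ∀ q : T, q ^ (ℓ ^ n.factorization ℓ) = 1 := by
    intro q
    apply Subtype.ext
    have hq : (q : Q) ∈ (powMonoidHom (ℓ ^ n.factorization ℓ) : Q →* Q).ker := q.2
    rw [MonoidHom.mem_ker, powMonoidHom_apply] at hq
    rw [Subgroup.coe_pow, Subgroup.coe_one]
    exact hq
  have hθTinv : ∀ (g y : SL(2, ℤ)) (hy : y ∈ Gamma N) (hgy : g * y * g⁻¹ ∈ Gamma N),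
      θT ⟨g * y * g⁻¹, hgy⟩ = θT ⟨y, hy⟩ := by
    intro g y hy hgy
    apply Subtype.ext
    rw [hθTval, hθTval, hθ g y hy hgy]
  have key : θ ⟨x, hx⟩ ^ m = 1 := by
    have h1 := cor453_invariant_form_exponent hℓ hN0 T (n.factorization ℓ) hQT θT hθTinv x hx hx12
    have h2 := congrArg Subtype.val h1
    rw [hθTval, Subgroup.coe_one] at h2
    exact h2
  have h1 : ℓ ∣ ordCompl[ℓ] n := hℓq.trans (orderOf_dvd_of_pow_eq_one key)
  exact hℓ.one_lt.ne' (Nat.Coprime.eq_one_of_dvd (Nat.coprime_ordCompl hℓ hn0) h1)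

/-- **The stub `stub_hcor_invariant` of line `cdt_thm1` (crux K★), in its exact shape, for ALL `N`**
(`M = 12N` for `N ≥ 1`; `Γ(0)` is trivial): an `SL₂(ℤ)`-conjugation-invariant homomorphism from `Γ(N)` to a
finite abelian group is trivial on some principal congruence subgroup.  K★ / Manin / BSD are NOT proved by this
theorem alone. [cite: CalegariDimitrovTang2025, Corollary 4.5.3] [cite: Beyl1986, Theorem] -/
theorem stub_hcor_invariant_all : ∀ (N : ℕ) (Q : Type) [CommGroup Q] [Finite Q] (θ : Gamma N →* Q),
      (∀ (g x : SL(2, ℤ)) (hx : x ∈ Gamma N) (hgx : g * x * g⁻¹ ∈ Gamma N),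
        θ ⟨g * x * g⁻¹, hgx⟩ = θ ⟨x, hx⟩) →
      ∃ M : ℕ, M ≠ 0 ∧ ∀ (x : SL(2, ℤ)) (hx : x ∈ Gamma N), x ∈ Gamma M → θ ⟨x, hx⟩ = 1 := by
  intro N Q _ _ θ hθ
  rcases Nat.eq_zero_or_pos N with hN0 | hNpos
  · subst hN0
    refine ⟨1, one_ne_zero, fun x hx _ ↦ ?_⟩
    have hx1 : x = 1 := by simpa [Gamma_zero_bot] using hx
    have h1 : (⟨x, hx⟩ : Gamma 0) = 1 := Subtype.ext hx1
    rw [h1, map_one]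
  · exact ⟨12 * N, Nat.mul_ne_zero (by norm_num) hNpos.ne', cor453_invariant_form hNpos.ne' Q θ hθ⟩

/-- **`Γ(12N) ≤ [SL₂(ℤ), Γ(N)]` for every `N ≥ 1`** (Beyl's exact level is `lcm(N, 12)`).
[cite: Beyl1986, Theorem] [cite: CalegariDimitrovTang2025, Corollary 4.5.3] -/
theorem Gamma_mul_le_commutator {N : ℕ} (hN0 : N ≠ 0) :
    Gamma (12 * N) ≤ ⁅(⊤ : Subgroup SL(2, ℤ)), Gamma N⁆ := by
  classical
  haveI : NeZero N := ⟨hN0⟩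
  let K' : Subgroup (Gamma N) := (⁅(⊤ : Subgroup SL(2, ℤ)), Gamma N⁆).subgroupOf (Gamma N)
  obtain ⟨B, hinv0, hθ₀⟩ := exists_universal_invariant_hom N
  let θ₀ : Gamma N →* Abelianization (Gamma N) ⧸ B := (QuotientGroup.mk' B).comp Abelianization.of
  have hsurj : Function.Surjective θ₀ :=
    (QuotientGroup.mk'_surjective B).comp QuotientGroup.mk_surjective
  haveI := finiteIndex_commutator_top_Gamma N
  have hK'fin : K'.index ≠ 0 := by
    intro h0
    have h := Subgroup.relIndex_mul_index
      (show ⁅(⊤ : Subgroup SL(2, ℤ)), Gamma N⁆ ≤ Gamma N from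
        Subgroup.commutator_le_right _ _ (h := Gamma_normal N))
    rw [Subgroup.relIndex, show (⁅(⊤ : Subgroup SL(2, ℤ)), Gamma N⁆.subgroupOf (Gamma N)).index = 0
      from h0, zero_mul] at h
    exact Subgroup.FiniteIndex.index_ne_zero h.symm
  have hker : θ₀.ker = K' := by
    ext x
    rw [MonoidHom.mem_ker, hθ₀, Subgroup.mem_subgroupOf]
  haveI : Finite (Abelianization (Gamma N) ⧸ B) := by
    have hcard : Nat.card (Abelianization (Gamma N) ⧸ B) = K'.index := by
      rw [← hker, Subgroup.index_ker, MonoidHom.range_eq_top.mpr hsurj, Subgroup.card_top]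
    exact Nat.finite_of_card_ne_zero (hcard ▸ hK'fin)
  intro x hx12
  have hx : x ∈ Gamma N := Gamma_le_Gamma_of_dvd₁₇ (dvd_mul_left N 12) hx12
  exact (hθ₀ ⟨x, hx⟩).mp (cor453_invariant_form hN0 _ θ₀ hinv0 x hx hx12)

end HcorTwoPow

end Summit.BirchSwinnertonDyer.BirchSwinnertonDyer.Theorems
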